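import Mathlib.Tactic.Linarith
import Mathlib.Tactic.Ring
import Mathlib.Tactic.NormNum
import HarnessLib

/-!
# The (0,1) cell of the ι-window, EXISTENCE side on the genus-4 Jacobian: glued two-component supports `(W₂ + a) ∪ (−W₂ − a)`,
# the vertex row `R_vtx` of `C − C`, and the reducible theta complete intersections

Family `hodge`, layer `Literature/AlgebraicGeometry/HodgeTheory`. Companion to `SemiregularityIotaWindowVoid.lean` (sections
`H2ZeroOneSieve`, `H2ZeroOneTorsion`, `H2ZeroOneTrace` = generations 13–15 of the pv1 line) with the SAME dictionary: `X = J = J(C)`, `C` a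
general curve of genus 4 (non-hyperelliptic, two `g¹₃`'s `g`, `h` with `g + h = K_C`, `Aut C = 1`, `End J = ℤ`), `ι = −1`, `Θ = W₃ − κ`
symmetric, `θ⁴ = 24`, `γ = θ³/6 = [C]`, `[W₂] = θ²/2`; a would-be `(0,1)` object `F` is a simple `ι`-equivariant sheaf with
`χ(F(mΘ)) = 2m⁴ − 12m² + 8m`, all local indices `t_p = 0`, `e₁^ι = 1`; shape (4.5)(a): `F = ker(E ↠ T)`, `E` a flat rank-2 hull (`χ(E(m)) = 2m⁴`),
so `χ(T(mΘ)) = 12m² − 8m`. Ladder note `papers/HodgeConjecture/hodge-weil-ladder` (packet `run/shared/lean/b2b/hodge-weil/`), CLAIM TABLE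
v20 (LADDER C139) row pv3-g8, report `b2b-hweil-pv3-g8/H2-EXISTENCE-SIDE.md`, scripts `code/pv3-g8/existence_side.py` (exact numerics,
every `assert` of which is one of the statements below or a table entry quoted in the report) and `code/pv3-g8/lp_alpha.py`. Def-free, fully
proved ELEMENTARY statements (integer arithmetic of intersection numbers and Euler characteristics); the geometry is in the docstrings and in
the report. HONEST FRAMING: census / negative results about the existence side of one cell of the ladder's H2 test; no case of the Hodge
conjecture is proved; nothing here is a rung; no statement of [Markman 2025] is used.

DICTIONARY (inputs in print). On the symmetric square `C₂ = C^{(2)} ≅ W₂` of a curve with general moduli the Néron–Severi group is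
`ℤx ⊕ ℤ(δ/2)` with `x = [p + C]`, `δ` = the diagonal [cite: Kouvidakis1993, Theorem 2], with `x² = 1`, `x·(δ/2) = 1`, `(δ/2)² = 1 − g`, the
theta class `θ|_{C₂} = (g+1)x − δ/2` and `K_{C₂} = (2g−2)x − δ/2`, `χ(𝒪_{C₂}) = (g−1)(g−2)/2` [cite: ArbarelloCornalbaGriffithsHarris1985, VIII §5
and VII §5]; for `g = 4`: `d := δ/2`, `h := θ| = 5x − d`, `K = 6x − d`, `h² = 12`, `h·K = 16`, `K² = 21`, `χ(𝒪) = 3`, `h·x = 4`, `h·d = 8`,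
so for `n = αx + βd`: `n·h = 4α + 8β`, `n·K = 5α + 9β`, `n² = α² + 2αβ − 3β²` (`numC2_genus4_forms`). The curve `T_L = {x + y ≤ D ∈ |L|}` of a
base-point-free pencil `L` has `x·T_L = deg L − 1` and `δ·T_L` = the Riemann–Hurwitz ramification count, whence `T_{g¹₃} ≡ 3x − d` (`≅ C`) and
`T_{g¹₄} ≡ 4x − d` (genus 9, `h`-degree 8: class `2γ` in `J`) (`trigonalCurve_class`, `tetragonalCurve_class`).

(G) GLUED SUPPORTS `Y_a = Y₁ ∪ Y₂`, `Y₁ = W₂ + a`, `Y₂ = ιY₁ = −W₂ − a` (`a ∈ Pic^{−2}C`; class `θ²`; `Y₁ ∩ Y₂` = the 6 points `p_i + p_j + a` of the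
divisor `p₁+…+p₄ ∈ |−2a|` when `h⁰(−2a) = 1`). For `T` of rank one on `Y_a` write `0 → G → G₁ ⊕ G₂ → R → 0` (`G` the pure part, `G_i` its
torsion-free image on `Y_i`, `G₂ = ι^*G₁`, `R` the GLUING sheaf, of length `r` when `Y₁ ∩ Y₂` is finite, of generic rank `ρ` on the curve
`Y₁ ∩ Y₂` in the excess stratum), `T₀ ⊂ T` the 0-dimensional torsion of length `t`, `G₁ = N₁ ⊗ 𝔞₁` with `N₁` invertible of class
`n₁ = αx + βd` and `𝔞₁` the base ideal of the two-section structure, of colength `ℓ₁ = n₁²` (the two section divisors are numerically `n₁`, as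
`det E|_{Y₁} ≡ 0`). Then `χ(T(m)) = 2χ(G₁(m)) − χ(R(m)) + t` with `χ(G₁(m)) = 3 + (n₁² − n₁·K)/2 − ℓ₁ + m(n₁·h − 8) + 6m²` and
`χ(R(m)) = 8ρm + χ_R`; the `m = 0, 1` extraction gives `n₁·h = 4 + 4ρ` and `6 + (n₁² − n₁K) − 2ℓ₁ − χ_R + t = 0` (`glued_two_point_extraction`,
`gluedCurve_two_point_extraction`). FINITE INTERSECTION (`ρ = 0`, `χ_R = r`): `ℓ₁ ≥ 0` leaves exactly `n₁ ∈ {x, 3x − d}` (`glued_hull_class`),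
and in both cases the constant term reads **`t = r`: the torsion length equals the gluing length** (`glued_constant_term`,
`glued_torsion_eq_gluing`). With the certified TORSION-MODULI lemma (torsion only at `ι`-fixed points of the support) and `Y_a ∩ J[2] = ∅`
for every `a` with `h⁰(−2a) = 1`, `−2a ≁ 2p + 2q`: `t = 0`, hence `r = 0`, the quotient is SPLIT and the certified (W⁻) family gives
`e₁^ι ≥ 4` — **G73-a is VOID off the two special strata**, without any local Poisson (LP) input (report §2). (Precisely: (TM) confines the
0-dimensional torsion to `ι`-fixed points, of which `Y_a` has none; torsion parked at 2-torsion points of `J` OFF `Y_a` is excluded separately —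
length 2 by an explicit `ℙ⁴` family (report Addendum 1 B), every length by the Quot-dimension sieve (pv3-g9 report §3) — so `t = 0` and the
statement is (8.3.3)-free. FOOTNOTE (pv3-g10, W-P3g9-f of referee-g49 R288 (iv); statement unchanged): the all-lengths exclusion of the
off-support torsion holds GIVEN the transport clause of PROPOSITION 3.4 of the pv3-g8 report ('any torsion at 2-torsion points of `J` off `Y`
is carried along unchanged in flat frames of `E`'), certified GP3g8-3 / R277 — the same footnote the census line (X6) carries; it is not an
extra hypothesis of the arithmetic below.) EXCESS STRATUM (`ρ = 1`,
`Y₁ ∩ Y₂ = Γ` a curve of class `4x − d` on `Y₁`, e.g. the reducible theta complete intersections `Θ_b ∩ Θ_{−b}`, `2b ∈ C − C ∖ 0`):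
`n₁ ∈ {2x, 4x − d, 6x − 2d}` (`gluedCurve_hull_class`) with required `χ_R = t − 8, t − 10, t − 6`; since `R ≅ G₂/G₂''` with
`G₂(−Γ) ⊆ G₂''` of rank 0 in `G₂|_Γ`, `χ_R ≥ n₁·Γ − 8 − ℓ₁` (snc along `Γ`), and this lower bound exceeds the requirement at `t = 0` by EXACTLY 2
in all three cases (`gluedCurve_margin_two`, `gluedCurve_void`).

(V) THE VERTEX ROW `R_vtx` (C130 (C3); GP14-7). `S = C − C = φ(C×C)`, `φ(x,y) = x − y`, swap hull `E = P_ξ ⊕ P_{−ξ}`, `D₁ = 2x₁`, `D₂ = 2x₂`,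
`A² = 𝒪(2x₁ + 2x₂)`, `sat = φ_*(A ⊠ A)`, `G = im(E_S → sat)` cosupported at the vertex, `h := h¹(C, 2x₁+2x₂) = h⁰(K − 2x₁ − 2x₂) ∈ {0,1}`.
Upstairs `0 → K → φ^*E → I → 0`, `0 → I → A⊠A → Q → 0` with `K = A⁻¹⊠A⁻¹`, `Q ≅ 𝒪/(u²,v²)` at `(x₁,x₁)` and `(x₂,x₂)` (length 8); the
`R¹φ_*` lengths by formal functions along `Δ` (graded pieces `H¹(C, L₀ ⊗ K^n)`; for `ζ⊠ζ⁻¹` the obstruction `δ₁` vanishes because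
`ζ ↦ (ζ⊠ζ⁻¹)|_{Δ₁}` is a holomorphic homomorphism `Pic⁰C → H¹(K_C) ≅ ℂ`, hence zero): `len R¹φ_*(A⊠A) = h`, `len R¹φ_*K = 8 + h`,
`len R¹φ_*φ^*E = 10`; with `κ := len ker(R¹φ_*K → R¹φ_*φ^*E)` the two long exact sequences give `c₀ := colength₀(G ⊂ sat) = 6 + 2h` and
`t = −χ(G) = c₀ − ch₄(sat) = 5 + h`, INDEPENDENT of `κ` (`rvtx_lengths`) — the exact values asked for in GP14-7 (`t = 5` for general
`(x₁,x₂)`, `t = 6` on the bitangent curve). Report §4 adds (not kernel statements): `C − C = Θ_n ∩ Θ_{−n}` (`n = g¹₃ − κ`) is a COMPLETE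
INTERSECTION of two theta translates (class count `diffSurface_class`), so the vertex equations are the even/odd parts of the Taylor series of
Riemann's theta function at its singular point; and `(C − C, 0)` is NOT analytically a cone for `g ≥ 2` (the second-order neighbourhood of the
diagonal does not split: obstruction `½λ²·c₁(T_C)`, `c₁(T_C) = 2 − 2g ≠ 0`, `diagonal_secondOrder_obstruction_ne_zero`).

What is NOT here: any (LP) verdict (those are machine statements of `lp_alpha.py`, [mod (8.3.3)]); the stratum-(α) normal forms and the
type-constancy argument (report §3); (MC); anything about objects. 0 unconditional rungs above the floor.
-/

namespace Literature.AlgebraicGeometry.HodgeTheory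

section H2ExistenceSide

/-- DICTIONARY CHECK (`C₂`, `g = 4`, basis `x`, `d = δ/2` with `x² = 1`, `x·d = 1`, `d² = −3`; `h = 5x − d`, `K = 6x − d`): for
`n = αx + βd` one has `n·h = 4α + 8β`, `n·K = 5α + 9β`, `n² = α² + 2αβ − 3β²`; and `h² = 12`, `h·K = 16`, `K² = 21`, `h·x = 4`, `h·d = 8`
[cite: Kouvidakis1993, Theorem 2; ArbarelloCornalbaGriffithsHarris1985, VIII §5]. -/
theorem numC2_genus4_forms (α β : ℤ) :
    (α * 5 + (α * (-1) + β * 5) * 1 + β * (-1) * (-3) = 4 * α + 8 * β) ∧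
    (α * 6 + (α * (-1) + β * 6) * 1 + β * (-1) * (-3) = 5 * α + 9 * β) ∧
    (α * α + (α * β + β * α) * 1 + β * β * (-3) = α ^ 2 + 2 * α * β - 3 * β ^ 2) ∧
    ((5 : ℤ) * 5 + (5 * (-1) + (-1) * 5) * 1 + (-1) * (-1) * (-3) = 12) ∧
    ((5 : ℤ) * 6 + (5 * (-1) + (-1) * 6) * 1 + (-1) * (-1) * (-3) = 16) ∧
    ((6 : ℤ) * 6 + (6 * (-1) + (-1) * 6) * 1 + (-1) * (-1) * (-3) = 21) := by
  refine ⟨by ring, by ring, by ring, by norm_num, by norm_num, by norm_num⟩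

/-- The curve `T_L = {x + y ≤ D ∈ |L|} ⊂ C₂` of a base-point-free `g¹₃` on the genus-4 curve: `x·T = 2` (the two partners of a point in
its trigonal divisor) and `δ·T = 12` (Riemann–Hurwitz ramification count), i.e. `(δ/2)·T = 6`; in the basis `T = αx + βd` this reads
`α + β = 2`, `α − 3β = 6`, so `T_{g¹₃} ≡ 3x − d` (`T² = 0`, `T·K = 6`: genus 4 — indeed `T_{g¹₃} ≅ C`). [folklore] -/
theorem trigonalCurve_class (α β : ℤ) (hx : α + β = 2) (hd : α - 3 * β = 6) :
    α = 3 ∧ β = -1 ∧ α ^ 2 + 2 * α * β - 3 * β ^ 2 = 0 ∧ 5 * α + 9 * β = 6 := by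
  have ha : α = 3 := by omega
  have hb : β = -1 := by omega
  subst ha; subst hb; norm_num

/-- Same for a base-point-free `g¹₄` `L` (e.g. `|K_C − c − c'|`): `x·T_L = 3`, `(δ/2)·T_L = 7` (ramification `2·4 + 6 = 14`), so
`T_L ≡ 4x − d`, `T_L² = 5`, `T_L·K = 11` (genus 9) and `T_L·h = 8`: the intersection curve of the two components of a reducible theta
complete intersection `Θ_b ∩ Θ_{−b}` (`2b ∈ C − C ∖ 0`) has class `2γ` in `J`. [folklore] -/
theorem tetragonalCurve_class (α β : ℤ) (hx : α + β = 3) (hd : α - 3 * β = 7) :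
    α = 4 ∧ β = -1 ∧ α ^ 2 + 2 * α * β - 3 * β ^ 2 = 5 ∧ 5 * α + 9 * β = 11 ∧ 4 * α + 8 * β = 8 := by
  have ha : α = 4 := by omega
  have hb : β = -1 := by omega
  subst ha; subst hb; norm_num

/-- TWO-POINT EXTRACTION, finite intersection (`ρ = 0`). With `χ(G₁(m)) = 3 + q₂ − ℓ + m(nh − 8) + 6m²` (`q₂ = (n₁² − n₁·K)/2`) the
identity `2χ(G₁(m)) − r + t = 12m² − 8m` at `m = 0` and `m = 1` forces `n₁·h = 4` and the constant-term relation
`6 + 2q₂ − 2ℓ − r + t = 0`. [folklore] -/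
theorem glued_two_point_extraction (nh q₂ ℓ r t : ℤ)
    (h0 : 2 * (3 + q₂ - ℓ) - r + t = 0)
    (h1 : 2 * (3 + q₂ - ℓ + (nh - 8) + 6) - r + t = 12 - 8) :
    nh = 4 ∧ 6 + 2 * q₂ - 2 * ℓ - r + t = 0 := by
  constructor <;> omega

/-- TWO-POINT EXTRACTION, excess intersection (`ρ = 1`: the gluing sheaf `R` has generic rank one on the curve `Y₁ ∩ Y₂` of
`θ`-degree 8, `χ(R(m)) = 8m + χ_R`): `n₁·h = 8` and `6 + 2q₂ − 2ℓ − χ_R + t = 0`. [folklore] -/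
theorem gluedCurve_two_point_extraction (nh q₂ ℓ χR t : ℤ)
    (h0 : 2 * (3 + q₂ - ℓ) - χR + t = 0)
    (h1 : 2 * (3 + q₂ - ℓ + (nh - 8) + 6) - (8 + χR) + t = 12 - 8) :
    nh = 8 ∧ 6 + 2 * q₂ - 2 * ℓ - χR + t = 0 := by
  constructor <;> omega

/-- HULL CLASSES on a glued support with finite intersection: `n₁·h = 4α + 8β = 4` and `ℓ₁ = n₁² = α² + 2αβ − 3β² ≥ 0` (the base
ideal has non-negative colength) leave exactly `n₁ = x` (`ℓ₁ = 1`) and `n₁ = 3x − d = [T_{g¹₃}]` (`ℓ₁ = 0`), up to `Pic⁰`. [folklore] -/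
theorem glued_hull_class (α β : ℤ) (hh : 4 * α + 8 * β = 4)
    (hℓ : 0 ≤ α ^ 2 + 2 * α * β - 3 * β ^ 2) : (α = 1 ∧ β = 0) ∨ (α = 3 ∧ β = -1) := by
  have hα : α = 1 - 2 * β := by omega
  subst hα
  have key : (3 * β - 1) * (β + 1) ≤ 0 := by nlinarith [hℓ]
  rcases mul_nonpos_iff.1 key with ⟨h1, h2⟩ | ⟨h1, h2⟩
  · omega
  · have hb : β = 0 ∨ β = -1 := by omega
    rcases hb with rfl | rfl <;> norm_num

/-- The constant term of the glued count as a function of `β` (with `α = 1 − 2β`, `q = n₁² − n₁·K = −3β² − β − 4`,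
`ℓ₁ = 1 − 2β − 3β²`): `6 + q − 2ℓ₁ = 3β(β + 1)`, which VANISHES at both admissible values `β ∈ {0, −1}`. [folklore] -/
theorem glued_constant_term (β : ℤ) :
    6 + (-3 * β ^ 2 - β - 4) - 2 * (1 - 2 * β - 3 * β ^ 2) = 3 * β * (β + 1) ∧
    (1 - 2 * β) ^ 2 + 2 * (1 - 2 * β) * β - 3 * β ^ 2 = 1 - 2 * β - 3 * β ^ 2 ∧
    ((1 - 2 * β) ^ 2 + 2 * (1 - 2 * β) * β - 3 * β ^ 2) - (5 * (1 - 2 * β) + 9 * β) = -3 * β ^ 2 - β - 4 := by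
  refine ⟨by ring, by ring, by ring⟩

/-- **`t = r` ON GLUED SUPPORTS.** For either admissible hull class (`β = 0`: `n₁ = x`; `β = −1`: `n₁ = 3x − d`) the constant-term relation
of the glued count reads `t = r`: the length of the 0-dimensional torsion of `T` equals the length of the gluing sheaf `R`. Consequence
(report §2, THEOREM G): where the support has no `ι`-fixed point the certified torsion-moduli lemma gives `t = 0`, so `r = 0`, the quotient
is split, and the certified opposite-translation family (W⁻) gives `e₁^ι ≥ 4` — no `(0,1)` object; no (LP) input. [folklore] -/
theorem glued_torsion_eq_gluing (β q ℓ r t : ℤ) (hβ : β = 0 ∨ β = -1)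
    (hq : q = -3 * β ^ 2 - β - 4) (hℓ : ℓ = 1 - 2 * β - 3 * β ^ 2)
    (hcst : 6 + q - 2 * ℓ - r + t = 0) : t = r := by
  have key : 6 + q - 2 * ℓ = 3 * β * (β + 1) := by subst hq; subst hℓ; ring
  have hz : 3 * β * (β + 1) = 0 := by
    rcases hβ with rfl | rfl <;> norm_num
  omega

/-- HULL CLASSES in the excess stratum (`ρ = 1`): `4α + 8β = 8` and `ℓ₁ = α² + 2αβ − 3β² ≥ 0` leave exactly
`n₁ ∈ {2x, 4x − d, 6x − 2d}` (`ℓ₁ = 4, 5, 0`). [folklore] -/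
theorem gluedCurve_hull_class (α β : ℤ) (hh : 4 * α + 8 * β = 8)
    (hℓ : 0 ≤ α ^ 2 + 2 * α * β - 3 * β ^ 2) :
    (α = 2 ∧ β = 0) ∨ (α = 4 ∧ β = -1) ∨ (α = 6 ∧ β = -2) := by
  have hα : α = 2 - 2 * β := by omega
  subst hα
  have key : (3 * β - 2) * (β + 2) ≤ 0 := by nlinarith [hℓ]
  rcases mul_nonpos_iff.1 key with ⟨h1, h2⟩ | ⟨h1, h2⟩
  · omega
  · have hb : β = 0 ∨ β = -1 ∨ β = -2 := by omega
    rcases hb with rfl | rfl | rfl <;> norm_num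

/-- THE MARGIN-TWO IDENTITY of the excess stratum. With `α = 2 − 2β`, `ℓ₁ = n₁²`, `q = n₁² − n₁·K`, `n₁·Γ = 3α + 7β` (`Γ ≡ 4x − d`):
the lower bound `χ_R ≥ n₁·Γ − 8 − ℓ₁` exceeds the value `χ_R = 6 + q − 2ℓ₁` required at `t = 0` by exactly 2, for EVERY `β`.
ERRATUM (pv3-g9, 2026-08-19; statement unchanged): earlier versions of this docstring and of the module header called this the 'snc lower
bound' and justified it by `G₂(−Γ) ⊆ G₂''`, which bounds `χ_R` from ABOVE (objection O-GE8-2, referee-g43). The bound itself is correct and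
needs no snc hypothesis: `R ≅ G₂/G₂''` with `G₂''' := 𝓘_{Y₁}G₂ ⊆ G₂'' ∩ G₂(−Γ)` of finite colength `c`, the rank-0 part `G₂''/G₂'''` sits in the
torsion of `G₂/G₂'''`, of length `≤ c + ℓ_Γ`, and the `c`'s cancel (report `b2b-hweil-pv3-g8/H2-EXISTENCE-SIDE.md` §5.2; certified R264 and
GP3g8-5/referee-g48, with W-GE8-2-a: cleanness of `S_b` along `Γ` from coplanarity, and W-GP3g8-5-a: the mixed-rank case on a reducible `Γ` is
excluded by parity). [folklore] -/
theorem gluedCurve_margin_two (α β ℓ q nΓ : ℤ) (hα : α = 2 - 2 * β)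
    (hℓ : ℓ = α ^ 2 + 2 * α * β - 3 * β ^ 2) (hq : q = ℓ - (5 * α + 9 * β)) (hΓ : nΓ = 3 * α + 7 * β) :
    (nΓ - 8 - ℓ) - (6 + q - 2 * ℓ) = 2 := by
  subst hα; subst hℓ; subst hq; subst hΓ; ring

/-- …hence the excess stratum is numerically VOID at `t = 0` (no `ι`-fixed point on the support; the qualifier 'snc along `Γ`' of earlier
versions is NOT needed — see the erratum above): a lower bound `L ≤ χ_R` with `L − req = 2` is incompatible with `χ_R = req`. [folklore] -/
theorem gluedCurve_void (χR L req : ℤ) (hbound : L ≤ χR) (hmargin : L - req = 2) (hreq : χR = req) : False := by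
  omega

/-- **`R_vtx` EXACT LENGTHS** (GP14-7). Bookkeeping of the two long exact `Rφ_*` sequences at the vertex of `C − C` (swap hull, `D_i = 2x_i`,
`h = h¹(2x₁+2x₂)`): `len Q = 8`, `len R¹φ_*(A⊠A) = h`, `len R¹φ_*K = 8 + h`, `len R¹φ_*φ^*E = 10`,
`len R¹φ_*I = len R¹φ_*φ^*E − (len R¹φ_*K − κ)`, `colength(sat/φ_*I) = len Q − (len R¹φ_*I − len R¹φ_*(A⊠A))`,
`colength(φ_*I/G) = κ`, `c₀ = sum`, `ch₄(sat) = χ(A)² + h = 1 + h`, `t = c₀ − ch₄(sat)`. CONCLUSION: `c₀ = 6 + 2h` and `t = 5 + h`, for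
every value of the unknown `κ = len ker(R¹φ_*K → R¹φ_*φ^*E)`. [folklore] -/
theorem rvtx_lengths (h κ lenQ r1AA r1K r1E r1I colSatI colIG c0 ch4 t : ℤ)
    (hQ : lenQ = 8) (hAA : r1AA = h) (hK : r1K = 8 + h) (hE : r1E = 10)
    (hI : r1I = r1E - (r1K - κ)) (h1 : colSatI = lenQ - (r1I - r1AA)) (h2 : colIG = κ)
    (hc0 : c0 = colSatI + colIG) (hch : ch4 = 1 + h) (ht : t = c0 - ch4) :
    c0 = 6 + 2 * h ∧ t = 5 + h := by
  constructor <;> omega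

/-- `R_vtx` SIGN BUDGET at the vertex (`t₀(T) = t₀(E) = 0`, `t₀(sat) = 16ε(h − 1)`): the composition signs `(n₊,n₋)` of `T₀` and `(m₊,m₋)`
of `sat/G` satisfy `n₊ − n₋ = (m₊ − m₋) + ε(1 − h)` with `n₊ + n₋ = 5 + h`, `m₊ + m₋ = 6 + 2h`; for `h = 0` this makes `n₊ − n₋` and
`m₊ − m₋` of opposite parity — consistent (`5` odd, `6` even): the budget does NOT exclude `R_vtx`. Recorded as the parity identity. [folklore] -/
theorem rvtx_sign_parity (h ε np nm mp mm : ℤ) (hε : ε = 1 ∨ ε = -1)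
    (hn : np + nm = 5 + h) (hm : mp + mm = 6 + 2 * h) (hbal : np - nm = (mp - mm) + ε * (1 - h)) :
    (np - nm) % 2 = (mp - mm + 1 + h) % 2 := by
  rcases hε with rfl | rfl <;> omega

/-- CLASS COUNT behind `C − C = Θ_n ∩ Θ_{−n}` (report §4.1): on `C × C` (genus 4; `f₁f₂ = 1`, `f_iδ = 1`, `δ² = −6`, `f_i² = 0`) the
pull-back `φ^*θ ≡ 3f₁ + 3f₂ + δ` of the difference map has self-intersection `24 = θ⁴`, so `deg φ = 1` and `[C − C] = θ² = [Θ_n]·[Θ_{−n}]`;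
an effective cycle of class `θ²` containing the integral surface `C − C` of class `θ²` equals it. [folklore] -/
theorem diffSurface_class : (2 * (3 * 3) * 1 + 2 * (3 * 1) * 1 + 2 * (3 * 1) * 1 + 1 * (-6) : ℤ) = 24 := by
  norm_num

/-- THE VERTEX IS NOT A CONE (report §4.3, LEMMA V). A ring isomorphism `𝒪_{C×C}/I_Δ³ ≅ 𝒪_C ⊕ K ⊕ K²` over the identity of `C` would
restrict `pr₁^♯`, `pr₂^♯` to lifts `f ↦ f + λ_i df + D₂^{(i)} f` with `λ₁ − λ₂ = ±1`, and a lift with `λ ≠ 0` exists iff the Čech class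
`½λ²·c₁(T_C) ∈ H¹(C, K_C)` vanishes; `deg T_C = 2 − 2g ≠ 0` for `g ≥ 2` (here: the integer `2 − 2g` is non-zero and one of `λ₁, λ₂` is
non-zero). Hence the minimal resolutions of `(C − C, 0)` and of the cone over the canonical curve differ already to second order. [folklore] -/
theorem diagonal_secondOrder_obstruction_ne_zero (g : ℤ) (hg : 2 ≤ g) (l₁ l₂ : ℚ) (hl : l₁ - l₂ = 1 ∨ l₁ - l₂ = -1) :
    (2 - 2 * g ≠ 0) ∧ (l₁ ≠ 0 ∨ l₂ ≠ 0) := by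
  refine ⟨by omega, ?_⟩
  by_cases h1 : l₁ = 0
  · right
    intro h2
    rw [h1, h2] at hl
    norm_num at hl
  · exact Or.inl h1

/-- STRATUM (α) BOOKKEEPING (report §3; lengths from `existence_side.py` Part D, machine-exact): at the tangency point the gluing length is
`r₀ = 4` with a base point (`β = 0`) plus `r_± = 2` at the swapped transversal pair, so `t = r = 6`; and the fixed-point index balance
`n₊ − n₋ = ρ₊ − ρ₋ = 0` then forces the torsion to have signs `(3,3)`. [folklore] -/
theorem stratumAlpha_basePoint_torsion (r₀ rpm t np nm : ℤ) (h0 : r₀ = 4) (hpm : rpm = 2) (ht : t = r₀ + rpm)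
    (hsum : np + nm = t) (hbal : np - nm = 0) : t = 6 ∧ np = 3 ∧ nm = 3 := by
  refine ⟨by omega, by omega, by omega⟩

/-- STRATUM (α), hull `3x − d` glued at the tangency point (report §3): generic gluing length `r₀ = 3` (the difference `δ = b' − b` of the two
section ratios has vanishing linear part and a `u₁u₂` term), `r_± ∈ {0, 2}`, so `t = r ∈ {3, 5}`, with `n₊ − n₋ = ρ₊ − ρ₋ = −1`:
`(n₊, n₋) ∈ {(1,2), (2,3)}`. NOTE (pv3-g9; statement unchanged): on the geometry the branch `r_± = 2` with the GENERIC germ does not occur —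
the extra-gluing curve equals the jump curve, `D_± = J` (report Addendum 1 C, certified R266): off `J` one has `t = 3` (dead by type constancy),
on `J` the germ is the degenerate one with `t = 6`, signs `(3,3)` (`stratumAlpha_basePoint_torsion`'s numbers), killed (8.3.3)-free by the
Quot-dimension sieve (`SemiregularityQuotDimensionSieve.lean`, report `b2b-hweil-pv3-g9/H2-EXISTENCE-SIDE-2.md` §2). FOOTNOTE (pv3-g10,
W-P3g9-f of referee-g49 R288 (iv); statement unchanged): where the kill uses the 1-parameter transport along `J` (report 2.3 (c): all of `T₀`
at one point with the non-split shadows listed in report 2.5) it holds GIVEN PROPOSITION 3.4's transport clause of the pv3-g8 report (the germ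
is constantly `I_Y e₊ ⊕ A e₋` along `J`), certified GP3g8-3 / R277 — the footnote of census line (X12); the cases of report 2.3 (b) / 2.5 need
no transport. So the `t = 5` branch of this
lemma is vacuous; the arithmetic is kept as stated. [folklore] -/
theorem stratumAlpha_glued_torsion (r₀ rpm t np nm : ℤ) (h0 : r₀ = 3) (hpm : rpm = 0 ∨ rpm = 2) (ht : t = r₀ + rpm)
    (hsum : np + nm = t) (hbal : np - nm = -1) : (np = 1 ∧ nm = 2) ∨ (np = 2 ∧ nm = 3) := by
  rcases hpm with rfl | rfl <;> omega

end H2ExistenceSide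

end Literature.AlgebraicGeometry.HodgeTheory
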